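import Literature.Analysis.SpecialFunctions.DigammaVerticalSeries
import Literature.Analysis.SpecialFunctions.DigammaLogBound
import Literature.Analysis.SpecialFunctions.PolygammaSeries
import Literature.NumberTheory.LFunctions.WeilArchDensityAsymptotics
import HarnessLib

/-!
# Format C, entry theorem (L-C1) — IV: the scalar integrals and digamma series of the archimedean block

Helper file of the rh-explicit Weil-positivity programme (`--supports stmt-RiemannHypothesis-0098`; seat
rh-explicit-weil-2), RH-free, no definitions, no named facts.

The archimedean part of the window form, `∫₀^∞ e^{t/2}/(2 sinh t)·D_t(u) dt`, evaluated on a trigonometric window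
(sibling file `WeilFormatCEntryIncrement.lean`: `D_t` is the Hermitian form of an explicit kernel in `cos ω_n t`,
`sin ω_n t`, `t cos ω_n t` on `0 ≤ t ≤ 2a` and of `2δ_{nm}` beyond), reduces — after expanding the density as
`Σ_{k≥0} e^{−l_k t}`, `l_k = 2k + ½` (`hasSum_exp_neg_digammaNode_mul`) — to the elementary integrals and the three
digamma series proved here (Yoshida 1992, §5, the residue computation (5.9)–(5.14) done on the position side):

* `∫_0^T e^{−lt}cos ωt`, `∫_0^T e^{−lt}sin ωt`, `∫_0^T t e^{−lt}cos ωt`, `∫_0^T e^{−lt}`, `∫_T^∞ e^{−lt}` in closed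
  form when `ωT ∈ 2πℤ` (for the window `T = 2a`, `ω = ω_n = πn/a`, `ω_n T = 2πn`), via the complex primitives of
  `e^{st}` and `t e^{st}`, `s = −l + iω`;
* `Im ψ(¼ + iω/2) = Σ_k 2ω/(l_k² + ω²)` and `Re ψ′(¼ + iω/2) = Σ_k 4(l_k² − ω²)/(l_k² + ω²)²` (from the tree's
  Andrews–Askey–Roy series `hasSum_im_digamma`, `hasSum_iteratedDeriv_digamma`; the real part
  `Re ψ(¼ + iω/2) − ψ(¼) = Σ_k (2/l_k − 2l_k/(l_k² + ω²))` is the tree's `hasSum_digammaTerm`);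
* summability of the window-truncated sums `Σ_k e^{−2a l_k}(l_k² − ω²)/(l_k² + ω²)²`, `Σ_k e^{−2a l_k} ω/(l_k² + ω²)`
  (the "rapidly convergent" sums of Yoshida (5.15)/(5.16)).

References: H. Yoshida, Adv. Stud. Pure Math. 21 (1992) 281–325, §5 pp. 298–301 [Yoshida1992HermitianForms];
G. E. Andrews, R. Askey, R. Roy, *Special Functions* (1999), Thm 1.2.5 [AndrewsAskeyRoy1999].
-/

set_option linter.dupNamespace false

noncomputable section

open Complex Set MeasureTheory Finset intervalIntegral
open scoped Real ComplexConjugate BigOperators Topology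

namespace Summit.RiemannHypothesis.RiemannHypothesis.Theorems.WeilFormatC

open Literature.NumberTheory.LFunctions Literature.Analysis.SpecialFunctions

/-! ## Exponential integrals on `[0, T]` -/

/-- `∫_0^T e^{st} dt = (e^{sT} − 1)/s` for `s ≠ 0`. -/
theorem integral_cexp_mul_zero (T : ℝ) {s : ℂ} (hs : s ≠ 0) :
    ∫ t in (0 : ℝ)..T, cexp (s * t) = (cexp (s * T) - 1) / s := by
  rw [integral_exp_mul_complex hs]
  simp

/-- The complex antiderivative of `z e^{sz}`: `d/dz [e^{sz}(sz − 1)/s²] = z e^{sz}` (`s ≠ 0`). -/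
theorem hasDerivAt_cexp_mul_lin {s : ℂ} (hs : s ≠ 0) (z : ℂ) :
    HasDerivAt (fun z : ℂ ↦ cexp (s * z) * (s * z - 1) / s ^ 2) (z * cexp (s * z)) z := by
  have he : HasDerivAt (fun z : ℂ ↦ cexp (s * z)) (cexp (s * z) * (s * 1)) z :=
    ((hasDerivAt_id z).const_mul s).cexp
  have hl : HasDerivAt (fun z : ℂ ↦ s * z - 1) (s * 1) z :=
    ((hasDerivAt_id z).const_mul s).sub_const 1
  have h : HasDerivAt (fun z : ℂ ↦ cexp (s * z) * (s * z - 1) / s ^ 2)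
      ((cexp (s * z) * (s * 1) * (s * z - 1) + cexp (s * z) * (s * 1)) / s ^ 2) z :=
    (he.mul hl).div_const (s ^ 2)
  refine h.congr_deriv ?_
  rw [div_eq_iff (pow_ne_zero 2 hs)]
  ring

/-- `∫_0^T t e^{st} dt = (e^{sT}(sT − 1) + 1)/s²` for `s ≠ 0`. -/
theorem integral_mul_cexp_mul_zero (T : ℝ) {s : ℂ} (hs : s ≠ 0) :
    ∫ t in (0 : ℝ)..T, (t : ℂ) * cexp (s * t) = (cexp (s * T) * (s * T - 1) + 1) / s ^ 2 := by
  rw [integral_eq_sub_of_hasDerivAt (f := fun x : ℝ ↦ cexp (s * x) * (s * x - 1) / s ^ 2)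
    (fun t _ ↦ (hasDerivAt_cexp_mul_lin hs (t : ℂ)).comp_ofReal)
    (by apply Continuous.intervalIntegrable; fun_prop)]
  simp only [Complex.ofReal_zero, mul_zero, Complex.exp_zero, zero_sub, one_mul]
  rw [← sub_div]
  ring

/-- For `s = −l + iω` with `ωT ∈ 2πℤ`: `e^{sT} = e^{−lT}` (real). -/
theorem cexp_neg_add_mul_I_of_period {l ω T : ℝ} {m : ℤ} (hωT : ω * T = 2 * π * m) :
    cexp ((-(l : ℂ) + ω * I) * T) = (Real.exp (-(l * T)) : ℂ) := by
  rw [add_mul, Complex.exp_add, show (ω : ℂ) * I * T = ((m : ℤ) : ℂ) * (2 * π * I) by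
    rw [show (ω : ℂ) * I * T = ((ω * T : ℝ) : ℂ) * I by push_cast; ring, hωT]; push_cast; ring,
    Complex.exp_int_mul_two_pi_mul_I, mul_one, Complex.ofReal_exp]
  push_cast
  ring_nf

/-- `e^{(−l+iω)t} = e^{−lt}(cos ωt + i sin ωt)`. -/
theorem cexp_neg_add_mul_I_mul (l ω t : ℝ) :
    cexp ((-(l : ℂ) + ω * I) * t) =
      (Real.exp (-(l * t)) : ℂ) * ((Real.cos (ω * t) : ℂ) + (Real.sin (ω * t) : ℂ) * I) := by
  rw [show (-(l : ℂ) + ω * I) * t = ((-(l * t) : ℝ) : ℂ) + ((ω * t : ℝ) : ℂ) * I by push_cast; ring,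
    Complex.exp_add, Complex.exp_mul_I, ← Complex.ofReal_exp, ← Complex.ofReal_cos, ← Complex.ofReal_sin]

/-- `−l + iω ≠ 0` when `l² + ω² ≠ 0`. -/
theorem neg_add_mul_I_ne_zero {l ω : ℝ} (hs : l ^ 2 + ω ^ 2 ≠ 0) : (-(l : ℂ) + ω * I) ≠ 0 := by
  intro h
  have h1 := congrArg Complex.re h
  have h2 := congrArg Complex.im h
  simp at h1 h2
  apply hs
  rw [h1, h2]
  ring

/-- The quotient `(E − 1)/(−l + iω)` in Cartesian form. -/
theorem sub_one_div_neg_add_mul_I (E : ℝ) {l ω : ℝ} (hs : l ^ 2 + ω ^ 2 ≠ 0) :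
    ((E : ℂ) - 1) / (-(l : ℂ) + ω * I) =
      ((l * (1 - E) / (l ^ 2 + ω ^ 2) : ℝ) : ℂ) + ((ω * (1 - E) / (l ^ 2 + ω ^ 2) : ℝ) : ℂ) * I := by
  have hs' := neg_add_mul_I_ne_zero hs
  rw [div_eq_iff hs']
  apply Complex.ext
  · simp only [Complex.sub_re, Complex.ofReal_re, Complex.one_re, Complex.mul_re, Complex.add_re,
      Complex.ofReal_im, Complex.mul_im, Complex.I_re, Complex.I_im, Complex.add_im, Complex.neg_re,
      Complex.neg_im]
    field_simp
    ring
  · simp only [Complex.sub_im, Complex.ofReal_im, Complex.one_im, Complex.mul_im, Complex.add_re,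
      Complex.ofReal_re, Complex.mul_re, Complex.I_re, Complex.I_im, Complex.add_im, Complex.neg_re,
      Complex.neg_im]
    field_simp
    ring

/-- The quotient `(E((−l+iω)T − 1) + 1)/(−l + iω)²` in Cartesian form. -/
theorem lin_div_neg_add_mul_I_sq (E T : ℝ) {l ω : ℝ} (hs : l ^ 2 + ω ^ 2 ≠ 0) :
    ((E : ℂ) * ((-(l : ℂ) + ω * I) * T - 1) + 1) / (-(l : ℂ) + ω * I) ^ 2 =
      (((l ^ 2 - ω ^ 2) * (1 - E) / (l ^ 2 + ω ^ 2) ^ 2 - T * E * l / (l ^ 2 + ω ^ 2) : ℝ) : ℂ) +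
        ((2 * l * ω * (1 - E) / (l ^ 2 + ω ^ 2) ^ 2 - T * E * ω / (l ^ 2 + ω ^ 2) : ℝ) : ℂ) * I := by
  have hs' := neg_add_mul_I_ne_zero hs
  rw [div_eq_iff (pow_ne_zero 2 hs'), pow_two (-(l : ℂ) + ω * I)]
  apply Complex.ext
  · simp only [Complex.sub_re, Complex.ofReal_re, Complex.one_re, Complex.mul_re, Complex.add_re,
      Complex.ofReal_im, Complex.mul_im, Complex.I_re, Complex.I_im, Complex.add_im, Complex.neg_re,
      Complex.neg_im, Complex.sub_im, Complex.one_im]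
    field_simp
    ring
  · simp only [Complex.sub_im, Complex.ofReal_im, Complex.one_im, Complex.mul_im, Complex.add_re,
      Complex.ofReal_re, Complex.mul_re, Complex.I_re, Complex.I_im, Complex.add_im, Complex.neg_re,
      Complex.neg_im, Complex.sub_re, Complex.one_re]
    field_simp
    ring

/-- **`∫_0^T e^{−lt} cos(ωt) dt = l(1 − e^{−lT})/(l² + ω²)`** when `ωT ∈ 2πℤ` and `l² + ω² ≠ 0`. -/
theorem integral_exp_neg_mul_cos {l ω T : ℝ} {m : ℤ} (hωT : ω * T = 2 * π * m) (hs : l ^ 2 + ω ^ 2 ≠ 0) :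
    ∫ t in (0 : ℝ)..T, Real.exp (-(l * t)) * Real.cos (ω * t) =
      l * (1 - Real.exp (-(l * T))) / (l ^ 2 + ω ^ 2) := by
  have hs' := neg_add_mul_I_ne_zero hs
  have hint : IntervalIntegrable (fun t : ℝ ↦ cexp ((-(l : ℂ) + ω * I) * t)) volume 0 T := by
    apply Continuous.intervalIntegrable; fun_prop
  have hre : ∀ t : ℝ, Real.exp (-(l * t)) * Real.cos (ω * t) = (cexp ((-(l : ℂ) + ω * I) * t)).re := by
    intro t
    rw [cexp_neg_add_mul_I_mul]
    simp only [Complex.mul_re, Complex.add_re, Complex.ofReal_re, Complex.ofReal_im, Complex.mul_im,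
      Complex.I_re, Complex.I_im, Complex.add_im]
    ring
  simp_rw [hre]
  rw [show (∫ t in (0 : ℝ)..T, (cexp ((-(l : ℂ) + ω * I) * t)).re) =
      Complex.reCLM (∫ t in (0 : ℝ)..T, cexp ((-(l : ℂ) + ω * I) * t)) by
    rw [← Complex.reCLM.intervalIntegral_comp_comm hint]; rfl,
    integral_cexp_mul_zero T hs', cexp_neg_add_mul_I_of_period hωT, sub_one_div_neg_add_mul_I _ hs]
  simp only [Complex.reCLM_apply, Complex.add_re, Complex.ofReal_re, Complex.mul_re, Complex.I_re, Complex.I_im,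
    Complex.ofReal_im, mul_zero, sub_zero, add_zero, mul_one]

/-- **`∫_0^T e^{−lt} sin(ωt) dt = ω(1 − e^{−lT})/(l² + ω²)`** when `ωT ∈ 2πℤ` and `l² + ω² ≠ 0`. -/
theorem integral_exp_neg_mul_sin {l ω T : ℝ} {m : ℤ} (hωT : ω * T = 2 * π * m) (hs : l ^ 2 + ω ^ 2 ≠ 0) :
    ∫ t in (0 : ℝ)..T, Real.exp (-(l * t)) * Real.sin (ω * t) =
      ω * (1 - Real.exp (-(l * T))) / (l ^ 2 + ω ^ 2) := by
  have hs' := neg_add_mul_I_ne_zero hs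
  have hint : IntervalIntegrable (fun t : ℝ ↦ cexp ((-(l : ℂ) + ω * I) * t)) volume 0 T := by
    apply Continuous.intervalIntegrable; fun_prop
  have him : ∀ t : ℝ, Real.exp (-(l * t)) * Real.sin (ω * t) = (cexp ((-(l : ℂ) + ω * I) * t)).im := by
    intro t
    rw [cexp_neg_add_mul_I_mul]
    simp only [Complex.mul_re, Complex.add_re, Complex.ofReal_re, Complex.ofReal_im, Complex.mul_im,
      Complex.I_re, Complex.I_im, Complex.add_im]
    ring
  simp_rw [him]
  rw [show (∫ t in (0 : ℝ)..T, (cexp ((-(l : ℂ) + ω * I) * t)).im) =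
      Complex.imCLM (∫ t in (0 : ℝ)..T, cexp ((-(l : ℂ) + ω * I) * t)) by
    rw [← Complex.imCLM.intervalIntegral_comp_comm hint]; rfl,
    integral_cexp_mul_zero T hs', cexp_neg_add_mul_I_of_period hωT, sub_one_div_neg_add_mul_I _ hs]
  simp only [Complex.imCLM_apply, Complex.add_im, Complex.ofReal_im, Complex.mul_im, Complex.I_re, Complex.I_im,
    Complex.ofReal_re, mul_zero, zero_add, mul_one, add_zero]

/-- **`∫_0^T t e^{−lt} cos(ωt) dt = (l² − ω²)(1 − e^{−lT})/(l² + ω²)² − T e^{−lT} l/(l² + ω²)`**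
when `ωT ∈ 2πℤ` and `l² + ω² ≠ 0`. -/
theorem integral_mul_exp_neg_mul_cos {l ω T : ℝ} {m : ℤ} (hωT : ω * T = 2 * π * m) (hs : l ^ 2 + ω ^ 2 ≠ 0) :
    ∫ t in (0 : ℝ)..T, t * Real.exp (-(l * t)) * Real.cos (ω * t) =
      (l ^ 2 - ω ^ 2) * (1 - Real.exp (-(l * T))) / (l ^ 2 + ω ^ 2) ^ 2 -
        T * Real.exp (-(l * T)) * l / (l ^ 2 + ω ^ 2) := by
  have hs' := neg_add_mul_I_ne_zero hs
  have hint : IntervalIntegrable (fun t : ℝ ↦ (t : ℂ) * cexp ((-(l : ℂ) + ω * I) * t)) volume 0 T := by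
    apply Continuous.intervalIntegrable; fun_prop
  have hre : ∀ t : ℝ, t * Real.exp (-(l * t)) * Real.cos (ω * t) =
      ((t : ℂ) * cexp ((-(l : ℂ) + ω * I) * t)).re := by
    intro t
    rw [cexp_neg_add_mul_I_mul]
    simp only [Complex.mul_re, Complex.add_re, Complex.ofReal_re, Complex.ofReal_im, Complex.mul_im,
      Complex.I_re, Complex.I_im, Complex.add_im]
    ring
  simp_rw [hre]
  rw [show (∫ t in (0 : ℝ)..T, ((t : ℂ) * cexp ((-(l : ℂ) + ω * I) * t)).re) =
      Complex.reCLM (∫ t in (0 : ℝ)..T, (t : ℂ) * cexp ((-(l : ℂ) + ω * I) * t)) by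
    rw [← Complex.reCLM.intervalIntegral_comp_comm hint]; rfl,
    integral_mul_cexp_mul_zero T hs', cexp_neg_add_mul_I_of_period hωT, lin_div_neg_add_mul_I_sq _ _ hs]
  simp only [Complex.reCLM_apply, Complex.add_re, Complex.ofReal_re, Complex.mul_re, Complex.I_re, Complex.I_im,
    Complex.ofReal_im, mul_zero, sub_zero, add_zero, mul_one]

/-- `∫_0^T e^{−lt} dt = (1 − e^{−lT})/l` (`l ≠ 0`). -/
theorem integral_exp_neg_mul {l : ℝ} (hl : l ≠ 0) (T : ℝ) :
    ∫ t in (0 : ℝ)..T, Real.exp (-(l * t)) = (1 - Real.exp (-(l * T))) / l := by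
  have h := integral_exp_neg_mul_cos (l := l) (ω := 0) (T := T) (m := 0) (by simp) (by positivity)
  simp only [zero_mul, Real.cos_zero, mul_one] at h
  rw [h]
  field_simp
  ring

/-! ## The archimedean density as an exponential series -/

/-- **`e^{t/2}/(2 sinh t) = Σ_{k≥0} e^{−l_k t}`**, `l_k = 2k + ½`, for `t > 0` (geometric series of
`e^{−t/2}/(1 − e^{−2t})`). -/
theorem hasSum_exp_neg_digammaNode_mul {t : ℝ} (ht : 0 < t) :
    HasSum (fun k : ℕ ↦ Real.exp (-(digammaNode k * t))) (weilArchDensity t) := by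
  have hr0 : 0 ≤ Real.exp (-(2 * t)) := (Real.exp_pos _).le
  have hr1 : Real.exp (-(2 * t)) < 1 := Real.exp_lt_one_iff.2 (by linarith)
  have h := (hasSum_geometric_of_lt_one hr0 hr1).mul_left (Real.exp (-(t / 2)))
  rw [weilArchDensity_eq_exp_div ht.ne', div_eq_mul_inv]
  refine h.congr_fun fun k ↦ ?_
  rw [← Real.exp_nat_mul, ← Real.exp_add, digammaNode]
  congr 1
  ring

/-- Each term is at most `e^{−t/2}·(e^{−2t})^k`-small: `0 < e^{−l_k t} ≤ 1` for `t ≥ 0`. -/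
theorem exp_neg_digammaNode_mul_le_one {t : ℝ} (ht : 0 ≤ t) (k : ℕ) :
    Real.exp (-(digammaNode k * t)) ≤ 1 :=
  Real.exp_le_one_iff.2 (by have := digammaNode_pos k; nlinarith)

/-! ## The three digamma series on the line `Re w = 1/4` -/

/-- `‖(1/4 + iω/2) + k‖² = (l_k² + ω²)/4`. -/
theorem normSq_quarter_add (ω : ℝ) (k : ℕ) :
    Complex.normSq ((1 / 4 : ℂ) + (ω : ℂ) / 2 * I + k) = (digammaNode k ^ 2 + ω ^ 2) / 4 := by
  rw [Complex.normSq_apply]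
  simp only [Complex.add_re, Complex.add_im, Complex.mul_re, Complex.mul_im, Complex.I_re, Complex.I_im,
    Complex.div_ofNat_re, Complex.div_ofNat_im, Complex.ofReal_re, Complex.ofReal_im, Complex.natCast_re,
    Complex.natCast_im, Complex.one_re, Complex.one_im, digammaNode]
  norm_num
  ring

/-- **`Im ψ(¼ + iω/2) = Σ_k 2ω/(l_k² + ω²)`** (imaginary part of the series (1.2.13) of Andrews–Askey–Roy). -/
theorem hasSum_im_digamma_quarter (ω : ℝ) :
    HasSum (fun k : ℕ ↦ 2 * ω / (digammaNode k ^ 2 + ω ^ 2))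
      (Complex.digamma (1 / 4 + (ω : ℂ) / 2 * I)).im := by
  have hw : 0 < ((1 / 4 : ℂ) + (ω : ℂ) / 2 * I).re := by simp
  have h := Literature.Analysis.SpecialFunctions.Complex.hasSum_im_digamma hw
  refine h.congr_fun fun k ↦ ?_
  rw [Complex.sq_norm, normSq_quarter_add]
  have him : ((1 / 4 : ℂ) + (ω : ℂ) / 2 * I).im = ω / 2 := by simp
  rw [him]
  have hpos : 0 < digammaNode k ^ 2 + ω ^ 2 := by have := digammaNode_pos k; positivity
  field_simp
  ring

/-- **`Re ψ′(¼ + iω/2) = Σ_k 4(l_k² − ω²)/(l_k² + ω²)²`** (real part of the polygamma series (1.2.14), `k = 1`). -/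
theorem hasSum_re_deriv_digamma_quarter (ω : ℝ) :
    HasSum (fun k : ℕ ↦ 4 * (digammaNode k ^ 2 - ω ^ 2) / (digammaNode k ^ 2 + ω ^ 2) ^ 2)
      (deriv Complex.digamma (1 / 4 + (ω : ℂ) / 2 * I)).re := by
  have hw : 0 < ((1 / 4 : ℂ) + (ω : ℂ) / 2 * I).re := by simp
  have h := Complex.hasSum_re
    (Literature.Analysis.SpecialFunctions.Complex.hasSum_iteratedDeriv_digamma hw (k := 1) le_rfl)
  rw [iteratedDeriv_one] at h
  refine h.congr_fun fun k ↦ ?_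
  have hsq : ((1 / 4 : ℂ) + (ω : ℂ) / 2 * I + k) ^ 2 =
      (((digammaNode k ^ 2 - ω ^ 2) / 4 : ℝ) : ℂ) + ((digammaNode k * ω / 2 : ℝ) : ℂ) * I := by
    rw [show ((1 / 4 : ℂ) + (ω : ℂ) / 2 * I + k) = ((digammaNode k / 2 : ℝ) : ℂ) + ((ω / 2 : ℝ) : ℂ) * I by
      rw [digammaNode]; push_cast; ring]
    push_cast
    ring_nf
    rw [Complex.I_sq]
    ring
  have h1 : ((-1 : ℂ) ^ (1 + 1) * ((Nat.factorial 1 : ℕ) : ℂ) *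
      (((1 / 4 : ℂ) + (ω : ℂ) / 2 * I + k) ^ (1 + 1))⁻¹) = ((((1 / 4 : ℂ) + (ω : ℂ) / 2 * I + k) ^ 2)⁻¹) := by
    norm_num
  rw [h1, hsq, Complex.inv_re, Complex.normSq_apply]
  simp only [Complex.add_re, Complex.add_im, Complex.mul_re, Complex.mul_im, Complex.I_re, Complex.I_im,
    Complex.ofReal_re, Complex.ofReal_im, mul_zero, sub_zero, add_zero, mul_one, zero_add]
  have hpos : 0 < digammaNode k ^ 2 + ω ^ 2 := by have := digammaNode_pos k; positivity
  have hne : (digammaNode k ^ 2 - ω ^ 2) / 4 * ((digammaNode k ^ 2 - ω ^ 2) / 4) +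
      digammaNode k * ω / 2 * (digammaNode k * ω / 2) = (digammaNode k ^ 2 + ω ^ 2) ^ 2 / 16 := by ring
  rw [hne]
  field_simp
  ring

/-! ## Window-truncated exponential sums: summability -/

/-- `Σ_k e^{−2a l_k}` converges for `a > 0` (geometric, ratio `e^{−4a}`). -/
theorem summable_exp_neg_two_mul_digammaNode {a : ℝ} (ha : 0 < a) :
    Summable (fun k : ℕ ↦ Real.exp (-(2 * a * digammaNode k))) := by
  have h := (hasSum_exp_neg_digammaNode_mul (t := 2 * a) (by positivity)).summable
  refine h.congr fun k ↦ ?_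
  ring_nf

/-- A bounded sequence against `e^{−2a l_k}` is summable. -/
theorem summable_exp_neg_mul_of_bounded {a : ℝ} (ha : 0 < a) {b : ℕ → ℝ} {C : ℝ} (hb : ∀ k, |b k| ≤ C) :
    Summable (fun k : ℕ ↦ Real.exp (-(2 * a * digammaNode k)) * b k) := by
  refine Summable.of_norm_bounded (g := fun k ↦ C * Real.exp (-(2 * a * digammaNode k)))
    ((summable_exp_neg_two_mul_digammaNode ha).mul_left C) fun k ↦ ?_
  rw [Real.norm_eq_abs, abs_mul, abs_of_pos (Real.exp_pos _), mul_comm]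
  exact mul_le_mul_of_nonneg_right (hb k) (Real.exp_pos _).le

/-- `|(l_k² − ω²)/(l_k² + ω²)²| ≤ 4`. -/
theorem abs_sdiag_coeff_le (ω : ℝ) (k : ℕ) :
    |(digammaNode k ^ 2 - ω ^ 2) / (digammaNode k ^ 2 + ω ^ 2) ^ 2| ≤ 4 := by
  have hl := one_half_le_digammaNode k
  have hpos : 0 < digammaNode k ^ 2 + ω ^ 2 := by positivity
  rw [abs_div, abs_of_pos (by positivity : 0 < (digammaNode k ^ 2 + ω ^ 2) ^ 2), div_le_iff₀ (by positivity)]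
  have h1 : |digammaNode k ^ 2 - ω ^ 2| ≤ digammaNode k ^ 2 + ω ^ 2 := by
    rw [abs_le]; constructor <;> nlinarith [sq_nonneg ω, sq_nonneg (digammaNode k)]
  have h2 : 1 / 4 ≤ digammaNode k ^ 2 + ω ^ 2 := by nlinarith [sq_nonneg ω]
  nlinarith

/-- `|ω/(l_k² + ω²)| ≤ |ω|·4`. -/
theorem abs_s0_coeff_le (ω : ℝ) (k : ℕ) :
    |ω / (digammaNode k ^ 2 + ω ^ 2)| ≤ |ω| * 4 := by
  have hl := one_half_le_digammaNode k
  have hpos : 0 < digammaNode k ^ 2 + ω ^ 2 := by positivity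
  rw [abs_div, abs_of_pos hpos, div_le_iff₀ hpos]
  have h2 : 1 / 4 ≤ digammaNode k ^ 2 + ω ^ 2 := by nlinarith [sq_nonneg ω]
  nlinarith [abs_nonneg ω]

/-- The diagonal window sum `Σ_k e^{−2a l_k}(l_k² − ω²)/(l_k² + ω²)²` converges (`a > 0`). -/
theorem summable_sdiag {a : ℝ} (ha : 0 < a) (ω : ℝ) :
    Summable (fun k : ℕ ↦ Real.exp (-(2 * a * digammaNode k)) *
      ((digammaNode k ^ 2 - ω ^ 2) / (digammaNode k ^ 2 + ω ^ 2) ^ 2)) :=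
  summable_exp_neg_mul_of_bounded ha (abs_sdiag_coeff_le ω)

/-- The off-diagonal window sum `Σ_k e^{−2a l_k} ω/(l_k² + ω²)` converges (`a > 0`). -/
theorem summable_s0 {a : ℝ} (ha : 0 < a) (ω : ℝ) :
    Summable (fun k : ℕ ↦ Real.exp (-(2 * a * digammaNode k)) * (ω / (digammaNode k ^ 2 + ω ^ 2))) :=
  summable_exp_neg_mul_of_bounded ha (abs_s0_coeff_le ω)

end Summit.RiemannHypothesis.RiemannHypothesis.Theorems.WeilFormatC
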